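import Literature.Algebra.Homology.DiscreteRepTateDualityPrimary
import Literature.Algebra.Homology.DiscreteRepInvariantCores
import Literature.Algebra.Homology.DiscreteRepLayerColimitDesc
import Mathlib.Topology.Instances.AddCircle.Defs
import HarnessLib

/-!
# The invariant-map fields of `TateDualityHypothesesAt p` from layer data of a `P`-class formation:
# `inv_Γ ∘ cores_U = inv_U` WITHOUT surjectivity of `inv_Γ`, and `p`-surjectivity / `p`-divisibility /
# `H¹ = 0` from a compatible family of injective layer invariants with ranges `(1/[Γ:V])ℤ/ℤ`

Topic `Algebra/Homology`; namespace `Literature.Algebra.Homology.DiscreteRep`.  Theorems only; no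
definition, no named fact, no instance, no `sorry`.  Sequel of `DiscreteRepTateDualityPrimary` (brick D0
«ENGINE-p»: `TateDualityHypothesesAt`), door-c4 g15's `DiscreteRepInvariantCores` (`inv_Γ ∘ cores_U = inv_U`
from the `Res`-axiom — there with `inv_Γ` SURJECTIVE onto a divisible `Q`) and door-c4 g16's
`DiscreteRepLayerColimitDesc` (`IsCompatibleFamily`, `desc`, `desc_injective`, `mem_range_desc`).

WHY.  In a `P`-class formation (Harari §16.4) the invariant maps `inv_U : H²(U, C) → ℚ/ℤ` are only
INJECTIVE, with image `{q : ord q ∣ #U}`; door-c4's `inv_comp_extCores_eq` / `bijective_inv_comp_extCores`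
assume `inv_Γ` onto `ℚ/ℤ` (used to make `Res` surjective), so they do not apply to `(G_S, C̄_S)`.  Here the
surjectivity hypothesis is replaced by "`inv_U y ∈ [Γ:U] · range inv_Γ`" (which holds in a `P`-class
formation: both sides are `{q : ord q ∣ #U}`), and the fields `invAt_injective`, `exists_invAt_eq`,
`ext_triv_divisible (r = 2)`, `ext_one_eq_zero` of `TateDualityHypothesesAt p C inv` are derived from LAYER
data: a compatible family of injective maps `f_V : H²(Γ⧸V, C^V) →+ ℚ/ℤ` on a cofinal family of open normal
`V` with `range f_V = {q : [Γ:V] • q = 0}` (the finite layers' `inv_{Γ/V} : H²(Γ⧸V, C^V) ⥲ (1/[Γ:V])ℤ/ℤ`),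
the divisibility `p^∞ ∣ #Γ` (`∀ a, ∃ V, p^a ∣ [Γ:V]`), and `H¹(Γ⧸V, C^V) = 0`.

* §1 `ℚ/ℤ`: `AddCircle.exists_nsmul_eq_and_mul_nsmul_eq_zero` (`n • q = 0 ⇒ ∃ q', p • q' = q ∧ (p n) • q' = 0`);
* §2 **`inv_comp_extCores_eq_of_exists`**: `inv_Γ (cores_U y) = inv_U y` from `inv_U ∘ Res = [Γ:U] • inv_Γ`,
  `inv_U` injective and `∀ y, ∃ x, inv_U y = [Γ:U] • inv_Γ x`; hence `injective_inv_comp_extCores_of_exists`,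
  `exists_inv_comp_extCores_eq_of_exists` (the pair `invAt_injective` / `exists_invAt_eq` at `U` once `inv_U`
  has them);
* §3 at the level of `Γ` from a family `(V, f)`: **`exists_desc_eq_of_pow_nsmul_eq_zero`** (`p`-power torsion of
  `ℚ/ℤ` in the range of `desc`), **`exists_eq_nsmul_of_layers`** (`Ext²_{C_Γ}(ℤ, C)` is `p`-divisible),
  **`ext_one_eq_zero_of_layers`** (`Ext¹_{C_Γ}(ℤ, C) = 0` from `H¹(Γ⧸V, C^V) = 0` on a cofinal family).

Written for the background sub-lane «PT-Ш-S-TC» of crux `stmt-BirchSwinnertonDyer-19032` (cell bsd-eis;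
input D = Milne I Thm. 4.10 (a) for `G_S`): brick D0 «ENGINE-p», file 4 — the tools with which D2 turns
the `S`-idèle layer class modules `C_S(E)` (`IdeleCohomology.exists_isClassModule_classModUnits`) into the
invariant-map fields for `(G_S, C̄_S, inv_S)`.  HONEST FRAMING: homological algebra only; nothing about
number fields is proved here, no case of BSD.

## References
* D. Harari, *Galois Cohomology and Class Field Theory*, Universitext (2020), §16.1 Definition 16.3, §16.4
  (P-class formations: `inv_U` injective, Remark 16.24), Thm. 17.2. [Harari2020]
* J. S. Milne, *Arithmetic Duality Theorems* (2nd ed. 2006), I §1 (class formations (1.1); `P`-class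
  formations), I §4 (`(G_S, C_S)`). [MilneADT2006]
* J.-P. Serre, *Galois Cohomology* (1997), I §2.2 Proposition 8. [SerreGaloisCohomology1997]
-/

noncomputable section

namespace Literature.Algebra.Homology

namespace DiscreteRep

open CategoryTheory CategoryTheory.Limits CategoryTheory.Abelian

/-! ## §1 Division by `p` in `ℚ/ℤ` keeping control of the order -/

/-- In `ℚ/ℤ`: if `n • q = 0` then `q = p • q'` with `(p n) • q' = 0` (`q = a/n ↦ q' = a/(p n)`).
[cite: Harari2020, §16.1 Definition 16.3] -/
theorem AddCircle.exists_nsmul_eq_and_mul_nsmul_eq_zero (p n : ℕ) (hp : 0 < p) (q : AddCircle (1 : ℚ))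
    (hq : n • q = 0) : ∃ q' : AddCircle (1 : ℚ), p • q' = q ∧ (p * n) • q' = 0 := by
  have hp' : (p : ℚ) ≠ 0 := Nat.cast_ne_zero.2 hp.ne'
  induction q using QuotientAddGroup.induction_on with
  | H x =>
    refine ⟨((x / p : ℚ) : AddCircle (1 : ℚ)), ?_, ?_⟩
    · rw [← AddCircle.coe_nsmul, nsmul_eq_mul, mul_div_cancel₀ _ hp']
    · rw [← AddCircle.coe_nsmul, nsmul_eq_mul, Nat.cast_mul, mul_comm (p : ℚ) (n : ℚ), mul_assoc,
        mul_div_cancel₀ _ hp', ← nsmul_eq_mul, AddCircle.coe_nsmul, hq]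

/-- `n • q = 0` and `n ∣ m` give `m • q = 0`. [cite: Harari2020, §16.1 Definition 16.3] -/
theorem nsmul_eq_zero_of_dvd {A : Type*} [AddMonoid A] {q : A} {n m : ℕ} (h : n • q = 0) (hd : n ∣ m) :
    m • q = 0 := by
  obtain ⟨c, rfl⟩ := hd
  rw [mul_nsmul, h, nsmul_zero]

/-! ## §2 `inv_Γ ∘ cores_U = inv_U` without surjectivity of `inv_Γ` -/

section Cores

universe w' u

variable {k Γ : Type u} [CommRing k] [Group Γ] [TopologicalSpace Γ] [IsTopologicalGroup Γ]
  (U : Subgroup Γ) (hU : IsOpen (U : Set Γ)) [U.FiniteIndex] (C : DiscreteRepCat k Γ)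
  {Q : Type w'} [AddCommGroup Q] {n : ℕ}
  (invΓ : Ext (triv (k := k) (Γ := Γ) k) C n →+ Q)
  (invU : Ext ((resD k U).obj (triv (k := k) (Γ := Γ) k)) ((resD k U).obj C) n →+ Q)

/-- **`inv_Γ ∘ cores_U = inv_U` for a `P`-class formation**: from the `Res`-axiom
`inv_U (Res x) = [Γ:U] • inv_Γ x`, `inv_U` injective, and "every value of `inv_U` is `[Γ:U]` times a value
of `inv_Γ`" (in a `P`-class formation both are `{q : ord q ∣ #U}`) — no surjectivity of `inv_Γ` onto `Q`.
[cite: Harari2020, §16.4 Remark 16.24 and §16.1 Definition 16.3][cite: MilneADT2006, I §1 (1.1)] -/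
theorem inv_comp_extCores_eq_of_exists
    (hres : ∀ x, invU (extRes U (triv (k := k) (Γ := Γ) k) C n x) = U.index • invΓ x)
    (hinjU : Function.Injective invU) (hrange : ∀ y, ∃ x, invU y = U.index • invΓ x)
    (y : Ext ((resD k U).obj (triv (k := k) (Γ := Γ) k)) ((resD k U).obj C) n) :
    invΓ (extCores U hU C n y) = invU y := by
  obtain ⟨x, hx⟩ := hrange y
  have hy : y = extRes U (triv (k := k) (Γ := Γ) k) C n x := hinjU (by rw [hres, hx])
  rw [hy, extCores_extRes_eq_nsmul, map_nsmul, hres]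

/-- Hence `inv_Γ ∘ cores_U` is injective when `inv_U` is. [cite: Harari2020, §16.4 Remark 16.24] -/
theorem injective_inv_comp_extCores_of_exists
    (hres : ∀ x, invU (extRes U (triv (k := k) (Γ := Γ) k) C n x) = U.index • invΓ x)
    (hinjU : Function.Injective invU) (hrange : ∀ y, ∃ x, invU y = U.index • invΓ x) :
    Function.Injective (invΓ.comp (extCores U hU C n)) := by
  have key : invΓ.comp (extCores U hU C n) = invU :=
    AddMonoidHom.ext fun y => inv_comp_extCores_eq_of_exists U hU C invΓ invU hres hinjU hrange y
  rw [key]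
  exact hinjU

/-- And every value of `inv_U` is a value of `inv_Γ ∘ cores_U` (so the `p`-power torsion of `Q` is in the
range of `inv_Γ ∘ cores_U` as soon as it is in the range of `inv_U`). [cite: Harari2020, §16.4 Remark 16.24] -/
theorem exists_inv_comp_extCores_eq_of_exists
    (hres : ∀ x, invU (extRes U (triv (k := k) (Γ := Γ) k) C n x) = U.index • invΓ x)
    (hinjU : Function.Injective invU) (hrange : ∀ y, ∃ x, invU y = U.index • invΓ x)
    {q : Q} (hq : ∃ y, invU y = q) : ∃ y, invΓ.comp (extCores U hU C n) y = q := by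
  obtain ⟨y, rfl⟩ := hq
  exact ⟨y, inv_comp_extCores_eq_of_exists U hU C invΓ invU hres hinjU hrange y⟩

end Cores

/-! ## §3 The invariant map of `Γ` from a compatible family of injective layer invariants -/

section Layers

variable {Γ : Type} [Group Γ] [TopologicalSpace Γ] [IsTopologicalGroup Γ] [CompactSpace Γ]
  [TotallyDisconnectedSpace Γ] {ι : Type} (V : ι → OpenNormalSubgroup Γ) (C : DiscreteRepCat ℤ Γ)
  (f : ∀ i, groupCohomology ((invariantsQuotFunctor ℤ (V i : Subgroup Γ)).obj C) 2 →+ AddCircle (1 : ℚ))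
  {p : ℕ}

/-- **`p`-power torsion of `ℚ/ℤ` is in the range of the descended invariant map** when `p^∞ ∣ #Γ` along the
family (`∀ a, ∃ i, p^a ∣ [Γ : V i]`) and each layer invariant has range `{q : [Γ:V i] • q = 0}` (at least
`⊇`): the field `exists_invAt_eq` at `U = Γ`.
[cite: Harari2020, §16.4 Remark 16.24 (b), Remark 17.1][cite: MilneADT2006, I §1 and §4] -/
theorem exists_desc_eq_of_pow_nsmul_eq_zero (hf : LayerColimit.IsCompatibleFamily V C 2 f)
    (hrange : ∀ (i : ι) (q : AddCircle (1 : ℚ)), (V i : Subgroup Γ).index • q = 0 → q ∈ Set.range (f i))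
    (hp : ∀ a : ℕ, ∃ i, p ^ a ∣ (V i : Subgroup Γ).index) (a : ℕ) (q : AddCircle (1 : ℚ))
    (hq : p ^ a • q = 0) : ∃ x, LayerColimit.desc V C 2 f hf x = q := by
  obtain ⟨i, hi⟩ := hp a
  obtain ⟨c, hc⟩ := hrange i q (nsmul_eq_zero_of_dvd hq hi)
  exact LayerColimit.mem_range_desc hf i c hc

omit [TotallyDisconnectedSpace Γ] in
/-- Below two members of a compatible family there is a member whose index is divisible by `p` times the
index of the first, provided `p^∞ ∣ #Γ` along the family (`[Γ:V i] = p^v m`, `p ∤ m`; a member of index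
divisible by `p^{v+1}` and one below both). [cite: Harari2020, §16.4 Remark 16.24 (b)] -/
theorem exists_le_mul_index_dvd (hp : p.Prime) (hf : LayerColimit.IsCompatibleFamily V C 2 f)
    (hpow : ∀ a : ℕ, ∃ i, p ^ a ∣ (V i : Subgroup Γ).index) (i : ι) :
    ∃ j, (V j : Subgroup Γ) ≤ V i ∧ p * (V i : Subgroup Γ).index ∣ (V j : Subgroup Γ).index := by
  haveI := finiteIndex_of_openNormalSubgroup (V i)
  have hn : (V i : Subgroup Γ).index ≠ 0 := Subgroup.FiniteIndex.index_ne_zero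
  -- `[Γ : V i] = p ^ v * m` with `p ∤ m`
  obtain ⟨v, m, hm, hvm⟩ := Nat.exists_eq_pow_mul_and_not_dvd hn p hp.ne_one
  obtain ⟨i₁, hi₁⟩ := hpow (v + 1)
  obtain ⟨j, hj, hj₁⟩ := hf.exists_le_le (V i) (V i₁)
  refine ⟨j, hj, ?_⟩
  have h1 : (V i : Subgroup Γ).index ∣ (V j : Subgroup Γ).index := Subgroup.index_dvd_of_le hj
  have h2 : p ^ (v + 1) ∣ (V j : Subgroup Γ).index := hi₁.trans (Subgroup.index_dvd_of_le hj₁)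
  have hcop : Nat.Coprime (p ^ (v + 1)) m :=
    (Nat.Coprime.pow_left _ ((Nat.Prime.coprime_iff_not_dvd hp).2 hm))
  have h3 : m ∣ (V j : Subgroup Γ).index := (Dvd.intro_left _ hvm.symm).trans h1
  have h4 : p ^ (v + 1) * m ∣ (V j : Subgroup Γ).index := Nat.Coprime.mul_dvd_of_dvd_of_dvd hcop h2 h3
  rw [hvm, ← mul_assoc, ← pow_succ']
  exact h4

/-- **`Ext²_{C_Γ}(ℤ, C)` is `p`-divisible** when the layer invariants are injective with ranges
`{q : [Γ:V] • q = 0}` and `p^∞ ∣ #Γ` along the family: `x = Inf_V c`, `f_V c = a/[Γ:V]`, and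
`a/(p[Γ:V])` is a layer invariant at a member `W` with `p[Γ:V] ∣ [Γ:W]` — the field `ext_triv_divisible`
(`r = 2`) at `U = Γ`. [cite: Harari2020, §16.4 Remark 16.24 (b)][cite: MilneADT2006, I §1] -/
theorem exists_eq_nsmul_of_layers (hp : p.Prime) (hf : LayerColimit.IsCompatibleFamily V C 2 f)
    (hinj : ∀ i, Function.Injective (f i))
    (hrange : ∀ (i : ι) (q : AddCircle (1 : ℚ)), q ∈ Set.range (f i) ↔ (V i : Subgroup Γ).index • q = 0)
    (hpow : ∀ a : ℕ, ∃ i, p ^ a ∣ (V i : Subgroup Γ).index)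
    (x : Ext (triv (k := ℤ) (Γ := Γ) ℤ) C 2) : ∃ y, x = p • y := by
  obtain ⟨i, c, rfl⟩ := hf.exists_inflG_eq x
  have hq : (V i : Subgroup Γ).index • f i c = 0 := (hrange i (f i c)).1 ⟨c, rfl⟩
  obtain ⟨q', hpq', hq'⟩ := AddCircle.exists_nsmul_eq_and_mul_nsmul_eq_zero p _ hp.pos (f i c) hq
  obtain ⟨j, -, hj⟩ := exists_le_mul_index_dvd V C f hp hf hpow i
  obtain ⟨c', hc'⟩ := (hrange j q').2 (nsmul_eq_zero_of_dvd hq' hj)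
  refine ⟨LayerColimit.inflG (V j) C 2 c', LayerColimit.desc_injective hf hinj ?_⟩
  rw [map_nsmul, LayerColimit.desc_inflG, LayerColimit.desc_inflG, hc', hpq']

/-- **`Ext¹_{C_Γ}(ℤ, C) = 0` from `H¹(Γ⧸V, C^V) = 0` on a cofinal family** (each layer of a (`P`-)class
formation has `H¹ = 0`): the field `ext_one_eq_zero` at `U = Γ`. [cite: Harari2020, §16.1 Definition 16.1 and §16.4][cite: SerreGaloisCohomology1997, I §2.2 Proposition 8] -/
theorem ext_one_eq_zero_of_layers (hV : ∀ W : OpenNormalSubgroup Γ, ∃ i, (V i : Subgroup Γ) ≤ W)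
    (h1 : ∀ (i : ι) (c : groupCohomology ((invariantsQuotFunctor ℤ (V i : Subgroup Γ)).obj C) 1), c = 0)
    (x : Ext (triv (k := ℤ) (Γ := Γ) ℤ) C 1) : x = 0 := by
  obtain ⟨W, c, rfl⟩ := LayerColimit.exists_inflG_eq 1 C x
  obtain ⟨i, hi⟩ := hV W
  rw [← LayerColimit.inflG_stepG W (V i) hi C 1 c, h1 i (LayerColimit.stepG W (V i) hi C 1 c), map_zero]

/-- The descended invariant map is injective on each layer and globally (door-c4's `desc_injective`,
recorded in the form `invAt_injective` wants at `U = Γ`: `inv x = 0 → x = 0`).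
[cite: Harari2020, §16.4 Remark 16.24][cite: SerreGaloisCohomology1997, I §2.2 Proposition 8] -/
theorem desc_eq_zero_iff_of_injective (hf : LayerColimit.IsCompatibleFamily V C 2 f)
    (hinj : ∀ i, Function.Injective (f i)) (x : Ext (triv (k := ℤ) (Γ := Γ) ℤ) C 2) :
    LayerColimit.desc V C 2 f hf x = 0 ↔ x = 0 :=
  ⟨fun h => LayerColimit.desc_injective hf hinj (by rw [h, map_zero]), fun h => by rw [h, map_zero]⟩

end Layers

end DiscreteRep

end Literature.Algebra.Homology
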